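import Summits.BirchSwinnertonDyer.BirchSwinnertonDyer.Theorems.ErratumRoadFiveNonSurjCornerHybridFourStubs
import Summits.BirchSwinnertonDyer.BirchSwinnertonDyer.Theorems.ErratumRoadFiveNonSurjCornerHybridTwinMuAnDeepHida
import Summits.BirchSwinnertonDyer.BirchSwinnertonDyer.Theorems.ErratumRoadFiveNonSurjCornerHybridDeepWitnessHida
import HarnessLib

/-!
# Route `ErratumRoadFive` (rung K2), crux `NonSurjCorner` (item stmt-BirchSwinnertonDyer-19065), line `Lines/hybrid.lean`:
# THE TWO RESEARCH RESIDUES OF THE LINE AS `Prop` CONSTANTS (∃-shaped; r19–r24′ slots 1′ and 2″ VERBATIM), so the planner can item-state them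
# BY NAME as sharper gen-4 children, and the crux from them + route items
# (cell `bsd-stepL`, seat `bsd-stepL-corner-p1` g20; `--supports stmt-BirchSwinnertonDyer-19065`; pattern of `…NonSurjCornerDeepChildrenDefs` (g18) and
# `ClassRecordThreeEulerHalvesAtThreeCoStepLDefs` (tam3-p1 g19 → item 23334))

WHY THIS FILE. After twenty generations the (T4′) corner's line `hybrid` has NO kernel-sized stub left; its research content is exactly two
∃-shaped statements, both beyond print and both decidable per pair by one computation:
* **`NonSurjCornerDeepWitnessResidual`** (= r19–r24′ slot 1′ `stub_deepWitness57` VERBATIM): at every DEEP corner pair (`ClassX11b`, `ρ̄` not onto,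
  `p ∈ {5,7}`, `p ∣ ord_p Δ_min`, no (ram) witness, `0 < ord_p #Ш(E)_an`) SOME Heegner field `K`, SOME Manin-good frame `(Dt, H, ι, P)`, a refined-Kolyvagin
  certificate there IF that frame is deep, and analytic μ = 0 at the globally minimal models of THAT twist `E^{(d_K)}`. WEAKER than the gen-3 children
  23046 `NonSurjCornerKolyZDeep` (certificates at EVERY deep frame) ∧ 23047 `NonSurjCornerTwinMuAnDeep` (μ = 0 at EVERY Friedberg–Hoffstein twin), which
  imply it (`deepWitnessResidual_of_deepChildren`). In print: every Kolyvagin-conjecture theorem (W. Zhang 2014, Skinner–Zhang 2014, Sweeting 2022,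
  Burungale–Castella–Grossi–Skinner 2026) has `ρ̄` onto or `p ∤ N`; Greenberg's μ = 0 is known for no irreducible non-surjective image (Emerton–Pollack–Weston
  transfer it within `𝓗(ρ̄)`, where the corner's imaginary-dihedral classes have CM members whose CYCLOTOMIC μ is Iwasawa's open μ-conjecture over `K_ρ`).
* **`NonSurjCornerTwinLowerSupplyResidual`** (= r20–r24′ slot 2″ `stub_twinLowerSupply57` VERBATIM): at every corner pair the two twin-lower SUPPLIES —
  for every even set `T` of multiplicative primes SOME Friedberg–Hoffstein field with `T` inert carrying the twist's `≥`-display, and SOME Heegner field with `2`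
  split carrying the twist's `≥`-half. WEAKER than crux 19064 `X11aLowerHalf` (the rank-0 lower half at EVERY multiplicative X11a pair at `p ≥ 5` = rung K6),
  which implies it (`twinLowerSupplyResidual_of_x11aLowerHalf`); a DIFFERENT road in print-shape: ONE `p`-adic-unit twist per pair with prescribed splitting
  (Bruinier–Ono 2003 Cor. 2 ∕ Ono–Skinner 1998 give such twists only for NON-exceptional `p ∤ N` — the corner's `p` is exceptional (ρ̄ not onto) AND divides `N`).
* `nonSurjCorner_of_residuals_of_items`: the two residues + SIX route items BY NAME (23048, 19066, 27981, 19524, 19716) + the one print name of r25's stub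
  ⟹ `NonSurjCorner` (glue #26 re-keyed) — the composition of a gen-4 zero-research-stub edition if the planner files the residues as items.

HONEST FRAMING: two `Prop` constants (OPEN, ∃-shaped restatements of registered stub texts; tagged `@[conjecture]`), three bookkeeping theorems (no `sorry`);
NOTHING is asserted about any curve; no named fact minted; items 19065 ∕ 23046 ∕ 23047 ∕ 19064 stay open; no census word, tier or label moves (T7); BSD is
proved for no curve. Census (lane B corner5-p2 CENSUS-G9, `N ≤ 4·10¹⁰`): the deep residue bites at 1 ∕ 2 430 corner pairs at `p = 5`, 0 ∕ 57 at `p = 7`.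
References (locators only): [McCallumLMS1991] §5, Cor. 5.6; [Cha2005] Thm. 21, Rmk. 25; [WZhang2014] Thm. 1.1; [GreenbergLNM1716] §1 Conj. 1.11;
[FriedbergHoffstein1995] Thm. B; [OnoSkinner1998] Cor. 3; [BruinierOno2003] Cor. 2; [EmertonPollackWeston2006] Thm. 1; [Miller2011LMS] Def. 1.1.
-/

set_option autoImplicit false
set_option linter.dupNamespace false -- `Summit.BirchSwinnertonDyer.BirchSwinnertonDyer` (summit = problem), tree-wide

noncomputable section

open scoped Classical NumberField MatrixGroups ModularForm

namespace Summit.BirchSwinnertonDyer.BirchSwinnertonDyer.Theorems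

open CongruenceSubgroup WeierstrassCurve NumberField IsDedekindDomain Field
  Literature.NumberTheory.EllipticCurves
  Literature.NumberTheory.EllipticCurves.ModularForms
  Literature.NumberTheory.Automorphic
  Literature.NumberTheory.EllipticCurves.Rank1Residual
  Literature.NumberTheory.EllipticCurves.Rank1Residual.Typed
  Summit.BirchSwinnertonDyer.Rank1Residual
  Summit.BirchSwinnertonDyer.Rank1Residual.X11b.Three.Koly

/-! ### §1 The two research residues of line `hybrid` (OPEN; nothing asserted) -/

/-- [research residue 1 of crux 19065 `NonSurjCorner`, line `hybrid` slot 1′ `stub_deepWitness57` VERBATIM] **ONE deep witness per DEEP corner pair**: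
for every corner pair (`ClassX11b`, `ρ̄_{E,p}` not onto, `p ∈ {5,7}`, `p ∣ ord_p Δ_min`, no (ram) witness) with `#Ш(E)_an = s`, `0 < ord_p s`: SOME level
`N = N_E`, SOME imaginary quadratic `K` (`|d_K| > 4`, Heegner for `N`, `L(E^{(d_K)},1) ≠ 0`), SOME Manin-good Heegner datum `(Dt, H, ι, P)` (`p ∤ c(Dt)`,
`P ∈ E(K)` the Heegner point) such that (i) IF that frame is deep (`y_K ∈ p^{t+1}E(K)`, `t = ord_p ∏ c_ℓ`) a refined-Kolyvagin certificate of level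
`≤ t` exists there, and (ii) analytic μ = 0 (a unit coefficient of the period-normalised Mazur–Tate–Teitelbaum function, allowable root `±1`) holds at
every globally minimal model of the twist `E^{(d_K)}` that is a non-surjective X11a leaf with `p ∣ ord_p Δ_min`. OPEN class-wide; per pair ONE
computation. A `Prop` constant; nothing asserted. [cite: McCallumLMS1991, §5 (p. 303), Cor. 5.6 (p. 310) (shape)] [cite: Cha2005, Thm. 21 and Rmk. 25]
[cite: WZhang2014, Thm. 1.1 (shape; hypotheses NOT met)] [cite: GreenbergLNM1716, §1 Conj. 1.11 (p. 61)] -/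
@[conjecture]
def NonSurjCornerDeepWitnessResidual : Prop :=
  ∀ (W : WeierstrassCurve ℚ) [W.IsElliptic] [W.IsGloballyMinimal] (p : ℕ) [Fact p.Prime],
    ClassX11b W p → ¬ Surj W p → (p = 5 ∨ p = 7) → p ∣ padicValInt p W.minimalDiscriminantInt →
    ¬ Ram W p → (∃ s : ℚ, shaAn W = (s : ℂ) ∧ 0 < padicValRat p s) →
    ∃ (N : ℕ) (_ : NeZero N) (K : Type) (_ : Field K) (_ : NumberField K)
      (Dt : ModularParametrizationData W N) (H : HeegnerDatum N (NumberField.discr K)) (ι : K →+* ℂ)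
      (P : (W.baseChange K).toAffine.Point),
      W.conductorNorm ℤ = N ∧ IsImaginaryQuadratic K ∧ 4 < (NumberField.discr K).natAbs ∧
      SatisfiesHeegnerHypothesis N K ∧ (W.quadraticTwist (NumberField.discr K : ℚ)).entireLFunction 1 ≠ 0 ∧
      WeierstrassCurve.Affine.Point.map ι.toRatAlgHom P = heegnerPointComplex Dt H ∧ ¬ (p : ℤ) ∣ Dt.c ∧
      ((∃ (d₁ : KolyvaginHeegnerData Dt H.β ι 1) (y : (W.baseChange K).toAffine.Point),
          WeierstrassCurve.Affine.Point.map (W' := W) (algebraMap K (ringClassField K ι 1)).toRatAlgHom y =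
            d₁.derivedPoint ∧
          ∃ Q : (W.baseChange K).toAffine.Point, ((p ^ (padicValNat p W.tamagawaProduct + 1) : ℕ) : ℤ) • Q = y) →
        ∃ M : ℕ, M ≤ padicValNat p W.tamagawaProduct ∧ CertificateAt Dt H.β ι p M) ∧
      (∀ (Wd : WeierstrassCurve ℚ) [Wd.IsElliptic] [Wd.IsGloballyMinimal] (Cd : VariableChange ℚ),
        Cd • W.quadraticTwist (NumberField.discr K : ℚ) = Wd →
        ClassX11a Wd p → ¬ Surj Wd p → p ∣ padicValInt p Wd.minimalDiscriminantInt →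
        ∀ {N : ℕ} [NeZero N] (f : CuspForm (Gamma0 N) 2), IsNewformOf Wd f →
        ∀ (ϖ : ℚ), (ϖ : ℝ) * Wd.realPeriodRat = plusPeriod f →
        ∀ (a : ℚ_[p]) (L : PowerSeries ℚ_[p]),
          (Wd.HasSplitMultiplicativeReductionAtPrime p → a = 1) →
          (¬ Wd.HasSplitMultiplicativeReductionAtPrime p → a = -1) →
          IsMultPAdicLFunctionOf f p a L →
          ∃ n : ℕ, ‖PowerSeries.coeff n (PowerSeries.C ((ϖ : ℚ) : ℚ_[p]) * L)‖ = 1)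

/-- [research residue 2 of crux 19065 `NonSurjCorner`, line `hybrid` slot 2″ `stub_twinLowerSupply57` VERBATIM] **The twin-lower SUPPLIES of every
corner pair**: (i) `FHTwinLowerSupplyAt W p` — for every even set `T` of multiplicative primes SOME imaginary quadratic `K` (`|d_K| > 4`, `T` inert and
prime to `d_K`, every other bad prime split, `L(E^{(d_K)},1) ≠ 0`) with a globally minimal model of the twist carrying its `≥`-display; (ii) SOME
imaginary quadratic `K` (`|d_K| > 4`, Heegner for `N_E`, `2` split, `L(E^{(d_K)},1) ≠ 0`) whose twist's globally minimal non-surjective models carry the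
`≥`-half `Typed.MissingLowerBoundAt`. OPEN class-wide (one `p`-adic-unit twist with prescribed splitting per pair would do; Ono–Skinner ∕ Bruinier–Ono
supply such twists only for non-exceptional `p ∤ N`); per pair decidable. A `Prop` constant; nothing asserted.
[cite: FriedbergHoffstein1995, Thm. B (frame exists; shape)] [cite: OnoSkinner1998, Cor. 3 (shape; hypotheses NOT met)]
[cite: BruinierOno2003, Cor. 2 (non-exceptional primes only)] [cite: Skinner2016PacificMC, Thm. C (display shape)] -/
@[conjecture]
def NonSurjCornerTwinLowerSupplyResidual : Prop :=
  ∀ (W : WeierstrassCurve ℚ) [W.IsElliptic] [W.IsGloballyMinimal] (p : ℕ) [Fact p.Prime],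
    ClassX11b W p → ¬ Surj W p → (p = 5 ∨ p = 7) → p ∣ padicValInt p W.minimalDiscriminantInt → ¬ Ram W p →
    FHTwinLowerSupplyAt W p ∧
    (∃ (K : Type) (_ : Field K) (_ : NumberField K), IsImaginaryQuadratic K ∧ 4 < (NumberField.discr K).natAbs ∧
      SatisfiesHeegnerHypothesis (W.conductorNorm ℤ) K ∧ SatisfiesHeegnerHypothesis 2 K ∧
      (W.quadraticTwist (NumberField.discr K : ℚ)).entireLFunction 1 ≠ 0 ∧
      ∀ (Wd : WeierstrassCurve ℚ) [Wd.IsElliptic] [Wd.IsGloballyMinimal] (Cd : VariableChange ℚ),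
        Cd • W.quadraticTwist (NumberField.discr K : ℚ) = Wd → ¬ Surj Wd p → Typed.MissingLowerBoundAt Wd p)

/-! ### §2 Bookkeeping: the gen-3 items imply the residues; the residues + route items imply the crux -/

/-- **The gen-3 DEEP children imply residue 1** (a fortiori: Friedberg–Hoffstein, Mazur's Manin datum and modularity — conjuncts 6, 7, 5 of item 23048 —
choose the field and the frame; `deepWitness_of_kolyZShaAn_of_twinMuAnDeep`, g18). [cite: FriedbergHoffstein1995, Thm. B] [cite: Mazur1978, Cor. 4.1] -/
theorem deepWitnessResidual_of_deepChildren
    (hF : Summit.BirchSwinnertonDyer.BirchSwinnertonDyer.Theses.ErratumRoadFive.KatoTwinFactsFiveAnContra)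
    (hZ : Summit.BirchSwinnertonDyer.BirchSwinnertonDyer.Theses.ErratumRoadFive.NonSurjCornerKolyZDeep)
    (hμ : Summit.BirchSwinnertonDyer.BirchSwinnertonDyer.Theses.ErratumRoadFive.NonSurjCornerTwinMuAnDeep) :
    NonSurjCornerDeepWitnessResidual := by
  obtain ⟨-, -, -, -, hnf, hFHs, hMaz, -⟩ := id hF
  exact deepWitness_of_kolyZShaAn_of_twinMuAnDeep hnf hMaz hFHs hZ hμ

/-- **Crux 19064 `X11aLowerHalf` implies residue 2** (a fortiori, with GZK ∕ modularity ∕ the two Friedberg–Hoffstein facts — conjuncts of items 23048 and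
19066; `twinLowerSupply_of_x11aLowerHalf`, g18). [cite: Miller2011LMS, Def. 1.1] [cite: FriedbergHoffstein1995, Thm. B] -/
theorem twinLowerSupplyResidual_of_x11aLowerHalf
    (hF : Summit.BirchSwinnertonDyer.BirchSwinnertonDyer.Theses.ErratumRoadFive.KatoTwinFactsFiveAnContra)
    (h₅ : Summit.BirchSwinnertonDyer.BirchSwinnertonDyer.Theses.ErratumRoadFive.PublishedInputsFive)
    (h₃ : Summit.BirchSwinnertonDyer.BirchSwinnertonDyer.Theses.ErratumRoadFive.X11aLowerHalf) :
    NonSurjCornerTwinLowerSupplyResidual := by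
  obtain ⟨-, -, -, hGZK, hnf, hFHs, -⟩ := id hF
  exact twinLowerSupply_of_x11aLowerHalf hGZK (hasEntireLFunction_rat_of_exists_isNewformOf hnf) hnf hFHs
    h₅.2.2.2.2.2.2.2.2.2.2.2.2.1 h₃

/-- **The crux from the two residues + route items BY NAME + the one print name** (glue #26 re-keyed: slot 3 = item 23048, slot 5 = item 27981 ∧
(conjunct 13 of 19066, 19524, 19716, ‹primitives for irreducible `E[p]`›)) — the composition of a zero-research-stub edition once the residues are items.
CONDITIONAL; 19065 NOT closed by this file; T7. [cite: Cha2005, Thm. 21 and Rmk. 25] [cite: Miller2011LMS, Def. 1.1] -/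
theorem nonSurjCorner_of_residuals_of_items
    (hWit : NonSurjCornerDeepWitnessResidual) (hSup : NonSurjCornerTwinLowerSupplyResidual)
    (hF : Summit.BirchSwinnertonDyer.BirchSwinnertonDyer.Theses.ErratumRoadFive.KatoTwinFactsFiveAnContra)
    (h₅ : Summit.BirchSwinnertonDyer.BirchSwinnertonDyer.Theses.ErratumRoadFive.PublishedInputsFive)
    (hGr : Summit.BirchSwinnertonDyer.BirchSwinnertonDyer.Theses.ErratumRoadFive.EulerHalfGrossPrintFacts)
    (hJL : Summit.BirchSwinnertonDyer.BirchSwinnertonDyer.Theses.ErratumRoadFive.ShimuraParametrizationDataNonempty)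
    (hCO : Summit.BirchSwinnertonDyer.BirchSwinnertonDyer.Theses.ErratumRoadFive.PastenComponentOrdersInput)
    (hPrim : shimuraCurve_heegnerSystem_primitivesFromFiveIrr) :
    Summit.BirchSwinnertonDyer.BirchSwinnertonDyer.Theses.ErratumRoadFive.NonSurjCorner :=
  nonSurjCorner_of_deepWitness_of_twinLowerSupply_of_fifteenFacts_of_twoPlusFourNames_pAnchor hWit hSup hF hGr
    ⟨h₅.2.2.2.2.2.2.2.2.2.2.2.2.1, hJL, hCO, hPrim⟩

end Summit.BirchSwinnertonDyer.BirchSwinnertonDyer.Theorems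

end
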